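import Literature.AlgebraicGeometry.Hironaka2017.Lib.MonomialPartBlowup
import Literature.AlgebraicGeometry.Resolution.PrimeDivisorIdeals
import Literature.AlgebraicGeometry.Resolution.DivisorialPartLemmas
import Literature.AlgebraicGeometry.Resolution.OrderSemicontinuity
import Literature.AlgebraicGeometry.Resolution.ColonIdealSheafFG
import Literature.AlgebraicGeometry.Resolution.BlowupRestrictOpen
import Literature.AlgebraicGeometry.Resolution.Blowups
import Literature.AlgebraicGeometry.Resolution.BlowupChartMembership
import Literature.AlgebraicGeometry.Resolution.RegularCentreBlowupSeqIntegral
import Literature.AlgebraicGeometry.Resolution.AlterationsProofs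
import Literature.AlgebraicGeometry.Resolution.CanonicalResolutionSmoothCentre
import Literature.AlgebraicGeometry.Resolution.BlowupDisjointCentreSplitting
import HarnessLib

/-!
# Crux `PatchingRelPerfect` (stmt-ResolutionOfSingularities-16161), chain W5.2 — T6-E1b residual `LegalScopedDivisorReduction₃`,
# PHASE 2 closer (2b), brick B3′b (spec D3): the ORDER LAW of a curve move on the host — «T′ = T − Γ»

[OURS · L1 W5.2 · res-L1-w52-lead-1 g5, hand #3b; spec `L/res-L1-w52-lead-1/PHASE2-STEPB-SPEC.md` D3] Replaces the role of NO printed item;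
NOT a statement of the manuscript under review; fact-free.

A CURVE MOVE of the separation game blows up `E` along a regular curve `Γ = cl{ζ}` of the host `X` (`ζ` a codimension-one point of the
regular integral surface `X`, `P = 𝓘_X(Γ) = primeDivisorIdeal ζ` its Cartier prime ideal); on the host this is the blowing up
`π : X′ → X` along `P` — an ISOMORPHISM — and the trace of the boundary monomial transforms by brick B1's `HostState.trace_law`:
`T′ = (P𝒪)^{w−1} · πᶜ(T, w)` (`w` the boundary weight along `Γ`, `1 ≤ w ≤ ord_ζ T`). This file reads that law in divisor language:

* `comap_eq_exc_mul_trace` — **`T𝒪_{X′} = P𝒪_{X′} · T′`**: the move removes ONE copy of `Γ` from the trace («`T′ = T − Γ`»);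
* `idealOrder_exc_mul` — additivity of the order against a Cartier factor at a regular point;
* **`idealOrder_trace_self`** — over `ζ` the order DROPS BY ONE: `ord_{ζ′} T′ + 1 = ord_ζ T`;
* **`idealOrder_trace_of_ne`** — at every other codimension-one point it is UNCHANGED: `ord_{y′} T′ = ord_{π y′} T`.

Hence the measure `Σ_ζ ord_ζ T` over the codimension-one points of the trace support drops by exactly one per curve move (spec D2).

AI-written; AI review is weaker than expert review.

## References
* H. Matsumura, *Commutative Ring Theory* (1986), Thm. 11.1–11.2 (discrete valuation rings). [Matsumura1987]
* O. Zariski, P. Samuel, *Commutative Algebra* II (1960), Ch. VIII §1 Thm. 1. [ZariskiSamuel1960]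
* J. Kollár, *Lectures on Resolution of Singularities* (2007), 3.30.2. [Kollar2007]
-/

-- `Summit.<Summit>.<Sub>.Theorems` with `Sub = Summit` (single-conjunct summit, D-0017)
set_option linter.dupNamespace false

noncomputable section

open CategoryTheory CategoryTheory.Limits AlgebraicGeometry TopologicalSpace IsLocalRing
open Literature.AlgebraicGeometry.Resolution Scheme.IdealSheafData
open Literature.AlgebraicGeometry.Hironaka2017.MonomialPart

namespace Summit.ResolutionOfSingularities.ResolutionOfSingularities.Theorems

universe u

namespace DepthLegal

variable {X X' : Scheme.{u}} {π : X' ⟶ X} {P T : X.IdealSheafData} {w : ℕ}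

/-- **`T𝒪 = P𝒪 · T′`** for `T′ := (P𝒪)^{w−1} · πᶜ(T, w)`, `1 ≤ w`, `T ≤ P^w`, `π` a blowing up along `P`: `(P𝒪)^w · πᶜ(T, w) = T𝒪` and
`P𝒪 · (P𝒪)^{w−1} = (P𝒪)^w`. [cite: Kollar2007, 3.30.2] -/
theorem comap_eq_exc_mul_trace (hπ : IsBlowup π P) (hw : 1 ≤ w) (hle : T ≤ P ^ w) :
    T.comap π = P.comap π * (P.comap π ^ (w - 1) * controlledTransform π P T w) := by
  obtain ⟨k, rfl⟩ := Nat.exists_eq_add_of_le hw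
  rw [Nat.add_sub_cancel_left, ← mul_assoc, ← pow_succ', show k + 1 = 1 + k from Nat.add_comm k 1]
  exact (hπ.pow_mul_controlledTransform_eq (comap_le_comap_pow_of_le_pow hle π)).symm

/-- **Additivity of the order against an effective Cartier factor** at a point with regular local ring: `ord_x(G · F) = ord_x G + ord_x F`
when both orders are finite (the order of a regular local ring is a valuation; tree `idealOrder_mul_of_span_singleton`).
[cite: ZariskiSamuel1960, Ch. VIII §1 Thm. 1] -/
theorem idealOrder_exc_mul {Y : Scheme.{u}} {x : Y} [IsRegularLocalRing (Y.presheaf.stalk x)] {G F : Y.IdealSheafData}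
    (hG : IsEffectiveCartier G) {m d : ℕ} (hm : idealOrder G x = m) (hd : idealOrder F x = d) :
    idealOrder (G * F) x = ((m + d : ℕ) : ℕ∞) := by
  obtain ⟨g, -, hg⟩ := hG.exists_stalkIdeal_eq_span x
  refine idealOrder_mul_of_span_singleton G F hg ?_ ?_ hd
  · have h1 : stalkIdeal G x ≤ maximalIdeal (Y.presheaf.stalk x) ^ m := by rw [← le_idealOrder_iff, hm]
    exact h1 (hg ▸ Ideal.mem_span_singleton_self g)
  · intro hmem
    have h2 : ¬ stalkIdeal G x ≤ maximalIdeal (Y.presheaf.stalk x) ^ (m + 1) := by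
      rw [← le_idealOrder_iff, hm]
      exact_mod_cast Nat.lt_irrefl _ ∘ Nat.lt_of_succ_le
    exact h2 (by rw [hg]; exact (Ideal.span_singleton_le_iff_mem _).mpr hmem)

section Host

variable [IsIntegral X] [IsLocallyNoetherian X] (hX : Scheme.IsRegular X) {ζ : X} (hζ : Order.coheight ζ = 1)

include hX hζ

omit [IsIntegral X] [IsLocallyNoetherian X] in
/-- The prime divisor ideal of a codimension-one point of a regular integral scheme has order ONE at that point (`(𝓟_ζ)_ζ = 𝔪_ζ ≠ 𝔪_ζ²`).
[cite: Matsumura1987, Thm. 11.1] -/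
theorem idealOrder_primeDivisorIdeal_self : idealOrder (primeDivisorIdeal ζ) ζ = 1 := by
  haveI : IsRegularLocalRing (X.presheaf.stalk ζ) := hX ζ
  haveI := isDomain_of_isRegularLocalRing (X.presheaf.stalk ζ)
  refine le_antisymm ?_ ?_
  · by_contra hlt
    rw [not_le] at hlt
    have h2 : ((2 : ℕ) : ℕ∞) ≤ idealOrder (primeDivisorIdeal ζ) ζ := by
      have : (1 : ℕ∞) + 1 ≤ idealOrder (primeDivisorIdeal ζ) ζ := (ENat.add_one_le_iff (ENat.coe_ne_top 1)).mpr hlt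
      exact_mod_cast this
    rw [le_idealOrder_iff, stalkIdeal_primeDivisorIdeal_self] at h2
    exact maximalIdeal_pow_succ_ne (not_isField_stalk_of_coheight_eq_one (X := X) hζ) 1
      (le_antisymm (by rw [pow_one]; exact h2) (by rw [pow_one]; exact Ideal.pow_le_self two_ne_zero)).symm
  · rw [show (1 : ℕ∞) = ((1 : ℕ) : ℕ∞) from rfl, le_idealOrder_iff, stalkIdeal_primeDivisorIdeal_self, pow_one]

omit [IsIntegral X] [IsLocallyNoetherian X] hX in
/-- Off `cl{ζ}` — in particular at every OTHER codimension-one point — the prime divisor ideal has order ZERO. [folklore] -/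
theorem idealOrder_primeDivisorIdeal_of_ne {y : X} (hy : Order.coheight y = 1) (hne : ζ ≠ y) :
    idealOrder (primeDivisorIdeal ζ) y = 0 := by
  have h := stalkIdeal_primeDivisorIdeal_eq_top (not_specializes_of_coheight_eq_one hζ hy hne)
  refine le_antisymm ?_ bot_le
  by_contra hlt
  rw [not_le] at hlt
  have h1 : ((1 : ℕ) : ℕ∞) ≤ idealOrder (primeDivisorIdeal ζ) y := by
    have : (0 : ℕ∞) + 1 ≤ idealOrder (primeDivisorIdeal ζ) y := (ENat.add_one_le_iff (ENat.coe_ne_top 0)).mpr hlt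
    simpa using this
  rw [le_idealOrder_iff, h, pow_one, top_le_iff] at h1
  exact (maximalIdeal.isMaximal _).ne_top h1

omit [IsLocallyNoetherian X] in
/-- `ord_ζ T ≥ w ⇒ T ≤ 𝓟_ζ^w` on a regular integral scheme (tree `le_primeDivisorIdeal_pow_of_isRegular`). [cite: Matsumura1987, Thm. 11.2] -/
theorem le_primeDivisorIdeal_pow_of_le_idealOrder (hwT : (w : ℕ∞) ≤ idealOrder T ζ) : T ≤ primeDivisorIdeal ζ ^ w :=
  le_primeDivisorIdeal_pow_of_isRegular hX hζ ((le_idealOrder_iff T ζ w).mp hwT)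

/-- Along the blowing up of a regular integral scheme at the Cartier prime divisor `𝓟_ζ` (an ISOMORPHISM): the trace datum
`T′ := (𝓟_ζ𝒪)^{w−1} · πᶜ(T, w)` satisfies `T𝒪 = 𝓟_ζ𝒪 · T′`, the top scheme is regular and integral, and `T′ ≠ ⊥`. [cite: Kollar2007, 3.30.2] -/
theorem trace_facts (hπ : IsBlowup π (primeDivisorIdeal ζ)) (hT : T ≠ ⊥) (hw : 1 ≤ w) (hwT : (w : ℕ∞) ≤ idealOrder T ζ)
    [Nonempty X'] :
    T.comap π = (primeDivisorIdeal ζ).comap π *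
        ((primeDivisorIdeal ζ).comap π ^ (w - 1) * controlledTransform π (primeDivisorIdeal ζ) T w) ∧
      IsIso π ∧ Scheme.IsRegular X' ∧ IsIntegral X' ∧
      (primeDivisorIdeal ζ).comap π ^ (w - 1) * controlledTransform π (primeDivisorIdeal ζ) T w ≠ ⊥ := by
  have hcart := isEffectiveCartier_primeDivisorIdeal_of_isRegular hX hζ
  haveI : IsIso π := hπ.isIso hcart
  have hfac := comap_eq_exc_mul_trace hπ hw (le_primeDivisorIdeal_pow_of_le_idealOrder hX hζ hwT)
  have hX' : Scheme.IsRegular X' := Scheme.IsRegular.of_isOpenImmersion π hX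
  haveI : IsIntegral X' := isIntegral_of_isOpenImmersion π
  -- `T𝒪 ≠ ⊥`: the centre ideal is non-zero (its stalk at `ζ` is `𝔪_ζ ≠ 0`), so its support is a proper closed subset
  have hPne : primeDivisorIdeal ζ ≠ ⊥ := by
    intro h
    have h1 := stalkIdeal_primeDivisorIdeal_self ζ
    rw [h, stalkIdeal_bot] at h1
    exact not_isField_stalk_of_coheight_eq_one (X := X) hζ (IsLocalRing.isField_iff_maximalIdeal_eq.mpr h1.symm)
  have hsupp : (primeDivisorIdeal ζ).support ≠ ⊤ := fun h => hPne (Scheme.IdealSheafData.support_eq_top_iff.mp h)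
  have hTne : T.comap π ≠ ⊥ := hπ.comap_ne_bot hsupp hT
  refine ⟨hfac, ‹_›, hX', ‹_›, fun h0 => hTne ?_⟩
  rw [hfac, h0, mul_bot]

/-- [OURS · L1 W5.2] **THE ORDER LAW OVER THE CURVE: the trace order DROPS BY ONE.** For the blowing up `π : X′ → X` of the regular
integral `X` along `𝓟_ζ` (`ζ` of codimension one), `T ≠ ⊥` with `1 ≤ w ≤ ord_ζ T`, and `T′ := (𝓟_ζ𝒪)^{w−1} · πᶜ(T, w)`: at the point `ζ′`
over `ζ`, `ord_{ζ′} T′ + 1 = ord_ζ T`. [cite: Matsumura1987, Thm. 11.1] [cite: Kollar2007, 3.30.2] -/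
theorem idealOrder_trace_self (hπ : IsBlowup π (primeDivisorIdeal ζ)) (hT : T ≠ ⊥) (hw : 1 ≤ w)
    (hwT : (w : ℕ∞) ≤ idealOrder T ζ) {ζ' : X'} (hζ' : π ζ' = ζ) :
    idealOrder ((primeDivisorIdeal ζ).comap π ^ (w - 1) * controlledTransform π (primeDivisorIdeal ζ) T w) ζ' + 1 =
      idealOrder T ζ := by
  haveI : Nonempty X' := ⟨ζ'⟩
  haveI : IsLocallyNoetherian X' := hπ.isLocallyNoetherian
  obtain ⟨hfac, hiso, hX', hint, hT'ne⟩ := trace_facts hX hζ hπ hT hw hwT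
  haveI := hiso
  haveI : IsRegularLocalRing (X'.presheaf.stalk ζ') := hX' ζ'
  set T' := (primeDivisorIdeal ζ).comap π ^ (w - 1) * controlledTransform π (primeDivisorIdeal ζ) T w
  obtain ⟨d, hd⟩ := exists_idealOrder_eq_natCast hT'ne ζ'
  -- `ord_{ζ'} T𝒪 = ord_ζ T`, `ord_{ζ'} 𝓟_ζ𝒪 = ord_ζ 𝓟_ζ = 1`
  have hTo : idealOrder (T.comap π) ζ' = idealOrder T ζ := by rw [idealOrder_comap_of_isOpenImmersion, hζ']
  have hPo : idealOrder ((primeDivisorIdeal ζ).comap π) ζ' = (1 : ℕ) := by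
    rw [idealOrder_comap_of_isOpenImmersion, hζ', Nat.cast_one]; exact idealOrder_primeDivisorIdeal_self hX hζ
  have hprod := idealOrder_exc_mul (hπ.isEffectiveCartier) hPo hd
  rw [← hfac, hTo] at hprod
  rw [hd, hprod, Nat.cast_add, Nat.cast_one, add_comm]

/-- [OURS · L1 W5.2] **THE ORDER LAW OFF THE CURVE: the trace order at every OTHER codimension-one point is UNCHANGED.**
[cite: Matsumura1987, Thm. 11.1] [cite: Kollar2007, 3.30.2] -/
theorem idealOrder_trace_of_ne (hπ : IsBlowup π (primeDivisorIdeal ζ)) (hT : T ≠ ⊥) (hw : 1 ≤ w)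
    (hwT : (w : ℕ∞) ≤ idealOrder T ζ) {y' : X'} (hy : Order.coheight (π y') = 1) (hne : ζ ≠ π y') :
    idealOrder ((primeDivisorIdeal ζ).comap π ^ (w - 1) * controlledTransform π (primeDivisorIdeal ζ) T w) y' =
      idealOrder T (π y') := by
  haveI : Nonempty X' := ⟨y'⟩
  haveI : IsLocallyNoetherian X' := hπ.isLocallyNoetherian
  obtain ⟨hfac, hiso, hX', hint, hT'ne⟩ := trace_facts hX hζ hπ hT hw hwT
  haveI := hiso
  haveI : IsRegularLocalRing (X'.presheaf.stalk y') := hX' y'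
  set T' := (primeDivisorIdeal ζ).comap π ^ (w - 1) * controlledTransform π (primeDivisorIdeal ζ) T w
  obtain ⟨d, hd⟩ := exists_idealOrder_eq_natCast hT'ne y'
  have hTo : idealOrder (T.comap π) y' = idealOrder T (π y') := idealOrder_comap_of_isOpenImmersion π T y'
  have hPo : idealOrder ((primeDivisorIdeal ζ).comap π) y' = (0 : ℕ) := by
    rw [idealOrder_comap_of_isOpenImmersion, Nat.cast_zero]; exact idealOrder_primeDivisorIdeal_of_ne hζ hy hne
  have hprod := idealOrder_exc_mul (hπ.isEffectiveCartier) hPo hd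
  rw [← hfac, hTo, zero_add] at hprod
  rw [hd, hprod]

end Host

end DepthLegal

end Summit.ResolutionOfSingularities.ResolutionOfSingularities.Theorems

end
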